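import Literature.Computability.AlgebraicComplexity.TableauPolynomial
import Literature.Computability.AlgebraicComplexity.LinSubst
import Mathlib.LinearAlgebra.Matrix.Block
import Mathlib.LinearAlgebra.Matrix.Determinant.Basic
import Mathlib.Algebra.BigOperators.Ring.Finset
import HarnessLib

/-!
# Scaling of the tableau evaluation under triangular substitutions

Mathematical layer of the Lean checker of the GCT multiplicity-obstruction engine (cell `pub-gct`;
honest framing: rung-1 multiplicity-obstruction search for permanent versus determinant at small
`(n, m)`, no claim about VP ≠ VNP or P ≠ NP), step H1c (first half). For a tableau datum
`τ : TabM σ` whose column alternators sit on the LARGEST variables `x 0 > x 1 > ⋯` of a linearly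
ordered variable type `σ` (an antitone enumeration `x` of `σ`), and an upper triangular matrix
`A` (`A a b = 0` for `b < a`), the mathematical evaluator scales:

  `EC(A · P) = (∏_c ∏_{i < h c} A (x i) (x i)) · EC(P)`          (`TabM.EC_mapForms`)

where `A · P` transforms every linear form of the presentation `P` by `a ↦ A a` (which is how the
tree's substitution `linSubst A : X_i ↦ ∑_j A j i X_j` acts on presentations,
`linSubst_splfPoly`). Proof (Dörfler–Ikenmeyer–Panova 2020 §5 / Bürgisser–Ikenmeyer: the column
alternators `e_0 ∧ ⋯ ∧ e_{h-1}` are Borel eigenvectors): expand every box's transformed linear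
form (`symEntryM_mapForms`, multilinearity of the permanent in its columns), regroup the signed
sum over column bijections into one determinant per column (`EC_mapForms_expand`), and evaluate
those determinants: zero unless the new variables are a permutation of the column's variables,
in which case `sign · ∏ diag` (`det_lookup_eq_zero`, `det_lookup_perm`, from
`Matrix.det_permute'` and `Matrix.det_of_lowerTriangular`). Elementary [folklore].
-/

noncomputable section

open scoped BigOperators

namespace Literature.Computability.AlgebraicComplexity

namespace TableauEval

open MvPolynomial

variable {σ : Type*} [Fintype σ] {K : Type*} [CommRing K]

/-! ## §1 Transforming a presentation by a matrix -/

/-- Apply the matrix `A` to every linear form of a presentation: `a ↦ A a`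
(`(A a) j = ∑_v A j v a v`). [folklore] -/
def mapForms (A : Matrix σ σ K) {T m : ℕ} (form : Fin T → Fin m → σ → K) :
    Fin T → Fin m → σ → K :=
  fun t s => A.mulVec (form t s)

/-- The tree's substitution `X_i ↦ ∑_j A j i X_j` maps the linear form of `a` to the linear form
of `A a`. [folklore] -/
theorem linSubst_linForm (A : Matrix σ σ K) (a : σ → K) :
    linSubst σ K A (linForm a) = linForm (A.mulVec a) := by
  unfold linForm
  simp only [map_sum, map_mul, linSubst_C, linSubst_X, Finset.mul_sum, Matrix.mulVec,
    dotProduct]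
  rw [Finset.sum_comm]
  refine Finset.sum_congr rfl fun j _ => ?_
  rw [Finset.sum_mul]
  refine Finset.sum_congr rfl fun v _ => ?_
  rw [MvPolynomial.smul_eq_C_mul]
  ring

/-- `linSubst A` maps the form presented by `P` to the form presented by `A · P`. [folklore] -/
theorem linSubst_splfPoly (A : Matrix σ σ K) {T m : ℕ} (coef : Fin T → K)
    (form : Fin T → Fin m → σ → K) :
    linSubst σ K A (splfPoly coef form) = splfPoly coef (mapForms A form) := by
  unfold splfPoly mapForms
  simp only [map_sum, map_mul, linSubst_C, map_prod, linSubst_linForm]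

/-! ## §2 Multilinear expansion of the symmetric-tensor entry -/

/-- **Multilinearity**: the symmetric-tensor entry of `A · P` at the word `w` expands over words
`w'` with the weights `∏_s A (w s) (w' s)`. [folklore] -/
theorem symEntryM_mapForms (A : Matrix σ σ K) {T m : ℕ} (coef : Fin T → K)
    (form : Fin T → Fin m → σ → K) (w : Fin m → σ) :
    symEntryM coef (mapForms A form) w =
      ∑ w' : Fin m → σ, (∏ s, A (w s) (w' s)) * symEntryM coef form w' := by
  unfold symEntryM
  -- expand each permanent
  have hperm : ∀ t, (Matrix.of fun s s' => mapForms A form t s (w s')).permanent =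
      ∑ w' : Fin m → σ, (∏ s, A (w s) (w' s)) *
        (Matrix.of fun s s' => form t s (w' s')).permanent := by
    intro t
    simp only [Matrix.permanent, Matrix.of_apply, mapForms, Matrix.mulVec, dotProduct]
    -- ∑_ρ ∏_{s'} ∑_v A (w s') v * form t (ρ s') v
    have h1 : ∀ ρ : Equiv.Perm (Fin m),
        ∏ s', ∑ v, A (w s') v * form t (ρ s') v =
          ∑ w' : Fin m → σ, ∏ s', A (w s') (w' s') * form t (ρ s') (w' s') := fun ρ =>
      Fintype.prod_sum fun s' v => A (w s') v * form t (ρ s') v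
    simp only [h1, Finset.prod_mul_distrib]
    rw [Finset.sum_comm]
    refine Finset.sum_congr rfl fun w' _ => ?_
    rw [Finset.mul_sum]
  simp only [hperm, Finset.mul_sum]
  rw [Finset.sum_comm]
  refine Finset.sum_congr rfl fun w' _ => Finset.sum_congr rfl fun t _ => ?_
  ring

/-! ## §3 Determinants of triangular lookups -/

section Lookup

variable [LinearOrder σ]

/-- An antitone enumeration of `σ` by `0, …, N-1`: `x 0 > x 1 > ⋯ > x (N-1)` lists every
element. [folklore] -/
structure IsAntitoneEnum (x : ℕ → σ) (N : ℕ) : Prop where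
  /-- strictly decreasing on `[0, N)` -/
  anti : ∀ i j, i < j → j < N → x j < x i
  /-- exhaustive -/
  surj : ∀ v : σ, ∃ i < N, x i = v

variable {x : ℕ → σ} {N : ℕ}

omit [Fintype σ] in
/-- An antitone enumeration is injective on `[0, N)`. [folklore] -/
theorem IsAntitoneEnum.inj (hx : IsAntitoneEnum x N) {i j : ℕ} (hi : i < N) (hj : j < N)
    (h : x i = x j) : i = j := by
  rcases lt_trichotomy i j with hlt | heq | hgt
  · exact absurd h (ne_of_gt (hx.anti i j hlt hj))
  · exact heq
  · exact absurd h (ne_of_lt (hx.anti j i hgt hi))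

variable {A : Matrix σ σ K}

omit [Fintype σ] in
/-- If the looked-up variables are a permutation `κ` of the column variables `x 0, …, x (h-1)`,
the lookup determinant is `sign κ · ∏_{i<h} A (x i) (x i)` (for upper triangular `A`). [folklore] -/
theorem det_lookup_perm (hA : ∀ a b, b < a → A a b = 0) (hx : IsAntitoneEnum x N) {h : ℕ}
    (hh : h ≤ N) (κ : Equiv.Perm (Fin h)) :
    (Matrix.of fun i r : Fin h => A (x i) (x (κ r))).det =
      ((Equiv.Perm.sign κ : ℤ) : K) * ∏ i : Fin h, A (x i) (x i) := by
  have hsub : (Matrix.of fun i r : Fin h => A (x i) (x (κ r))) =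
      (Matrix.of fun i j : Fin h => A (x i) (x j)).submatrix id κ := rfl
  rw [hsub, Matrix.det_permute', Matrix.det_of_lowerTriangular]
  · rfl
  · intro i j hij
    exact hA _ _ (hx.anti i j hij (lt_of_lt_of_le j.isLt hh))

omit [Fintype σ] in
/-- If the looked-up variables are NOT a permutation of the column variables, the lookup
determinant vanishes (a variable outside `{x 0, …, x (h-1)}` is smaller than all of them and gives
a zero column; a repeated variable gives two equal columns). [folklore] -/
theorem det_lookup_eq_zero (hA : ∀ a b, b < a → A a b = 0) (hx : IsAntitoneEnum x N) {h : ℕ}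
    (V : Fin h → σ) (hV : ¬ ∃ κ : Equiv.Perm (Fin h), ∀ r, V r = x (κ r)) :
    (Matrix.of fun i r : Fin h => A (x i) (V r)).det = 0 := by
  classical
  by_contra hdet
  apply hV
  -- every looked-up variable is one of the column variables
  have hin : ∀ r, ∃ j : Fin h, V r = x j := by
    intro r
    obtain ⟨j, hjN, hj⟩ := hx.surj (V r)
    by_cases hjh : j < h
    · exact ⟨⟨j, hjh⟩, hj.symm⟩
    · exfalso
      apply hdet
      refine Matrix.det_eq_zero_of_column_eq_zero r fun i => ?_
      rw [Matrix.of_apply, ← hj]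
      exact hA _ _ (hx.anti i j (lt_of_lt_of_le i.isLt (not_lt.mp hjh)) hjN)
  choose κ hκ using hin
  have hinj : Function.Injective κ := by
    intro r r' hrr'
    by_contra hne
    apply hdet
    exact Matrix.det_zero_of_column_eq hne fun i => by rw [Matrix.of_apply, Matrix.of_apply, hκ, hκ, hrr']
  exact ⟨Equiv.ofBijective κ (Finite.injective_iff_bijective.mp hinj), fun r => hκ r⟩

end Lookup

/-! ## §4 Frames: boxes as a bijection -/

/-- A frame for a tableau datum: its box enumeration as an honest bijection
`Fin d × Fin m ≃ boxes`. [folklore] -/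
structure TabM.Frame (τ : TabM σ) where
  /-- the bijection `(label, index) ↦ box` -/
  boxEquiv : Fin τ.d × Fin τ.m ≃ (c : Fin τ.C) × Fin (τ.h c)
  /-- it is the datum's `box` -/
  box_eq : ∀ u s, τ.box u s = boxEquiv (u, s)

namespace TabM

variable {τ : TabM σ} (F : τ.Frame)

/-- Reindexing label-words `W : Fin d → Fin m → σ` as box-functions `V c r`. [folklore] -/
def Frame.toBoxFun (W : Fin τ.d → Fin τ.m → σ) : (c : Fin τ.C) → Fin (τ.h c) → σ :=
  fun c r => W (F.boxEquiv.symm ⟨c, r⟩).1 (F.boxEquiv.symm ⟨c, r⟩).2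

/-- … and back. [folklore] -/
def Frame.ofBoxFun (V : (c : Fin τ.C) → Fin (τ.h c) → σ) : Fin τ.d → Fin τ.m → σ :=
  fun u s => V (F.boxEquiv (u, s)).1 (F.boxEquiv (u, s)).2

/-- The two reindexings are inverse bijections. [folklore] -/
def Frame.wordEquiv : (Fin τ.d → Fin τ.m → σ) ≃ ((c : Fin τ.C) → Fin (τ.h c) → σ) where
  toFun := F.toBoxFun
  invFun := F.ofBoxFun
  left_inv W := by
    funext u s
    simp only [Frame.ofBoxFun, Frame.toBoxFun, Sigma.eta, Equiv.symm_apply_apply]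
  right_inv V := by
    funext c r
    simp only [Frame.ofBoxFun, Frame.toBoxFun]
    have h := F.boxEquiv.apply_symm_apply ⟨c, r⟩
    -- `boxEquiv (boxEquiv.symm ⟨c,r⟩) = ⟨c, r⟩`
    generalize hb : F.boxEquiv (F.boxEquiv.symm ⟨c, r⟩) = b at h
    cases h
    rfl

/-! ## §5 Expansion of `EC (A · P)` into column determinants -/

/-- **Expansion**: `EC(A · P) = ∑_V (∏_c det_c(V)) · ∏_u symEntryM P (V on the boxes of u)`,
`det_c(V) = det (A (var c i) (V c r))_{i,r}`. [folklore] -/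
theorem EC_mapForms_expand (A : Matrix σ σ K) {T : ℕ} (coef : Fin T → K)
    (form : Fin T → Fin τ.m → σ → K) :
    τ.EC coef (mapForms A form) =
      ∑ V : ((c : Fin τ.C) → Fin (τ.h c) → σ),
        (∏ c, (Matrix.of fun i r : Fin (τ.h c) => A (τ.var c i) (V c r)).det) *
          ∏ u, symEntryM coef form (F.ofBoxFun V u) := by
  classical
  unfold EC
  -- Step 1: expand every label's symmetric-tensor entry and distribute the product over labels
  have h1 : ∀ π : τ.Bij, ∏ u, symEntryM coef (mapForms A form) (τ.word π u) =
      ∑ W : Fin τ.d → Fin τ.m → σ,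
        (∏ u, ∏ s, A (τ.word π u s) (W u s)) * ∏ u, symEntryM coef form (W u) := by
    intro π
    simp only [symEntryM_mapForms]
    rw [Fintype.prod_sum fun u (w' : Fin τ.m → σ) => (∏ s, A (τ.word π u s) (w' s)) *
      symEntryM coef form w']
    refine Finset.sum_congr rfl fun W _ => ?_
    rw [Finset.prod_mul_distrib]
  simp only [h1, Finset.mul_sum]
  rw [Finset.sum_comm]
  -- Step 2: reindex label-words by box-functions
  rw [← Equiv.sum_comp F.wordEquiv.symm]
  refine Finset.sum_congr rfl fun V _ => ?_
  have hW : F.wordEquiv.symm V = F.ofBoxFun V := rfl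
  simp only [hW]
  -- Step 3: the weight of (π, V) factorises over columns; the signed sum over π is ∏_c det
  have h3 : ∀ π : τ.Bij, ∏ u, ∏ s, A (τ.word π u s) (F.ofBoxFun V u s) =
      ∏ c, ∏ r : Fin (τ.h c), A (τ.var c (π c r)) (V c r) := by
    intro π
    rw [← Finset.prod_product', ← Fintype.prod_sigma' fun c (r : Fin (τ.h c)) =>
      A (τ.var c (π c r)) (V c r), ← F.boxEquiv.prod_comp]
    refine Finset.prod_congr rfl fun p _ => ?_
    obtain ⟨u, s⟩ := p
    simp only [TabM.word, Frame.ofBoxFun]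
    rw [F.box_eq u s]
  simp only [← mul_assoc, h3, ← Finset.sum_mul]
  congr 1
  -- ∑_π sgn(π) ∏_c ∏_r … = ∏_c det
  simp only [TabM.sgnProd, Units.coe_prod, Int.cast_prod, ← Finset.prod_mul_distrib]
  rw [← Fintype.prod_sum fun c (ρ : Equiv.Perm (Fin (τ.h c))) =>
    ((Equiv.Perm.sign ρ : ℤ) : K) * ∏ r, A (τ.var c (ρ r)) (V c r)]
  refine Finset.prod_congr rfl fun c _ => ?_
  rw [Matrix.det_apply']
  rfl

/-! ## §6 The scaling theorem -/

/-- **Scaling under upper triangular substitutions.** If the column alternators sit on the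
largest variables (`var c r = x r` for an antitone enumeration `x` of `σ`) and `A` is upper
triangular, then `EC(A · P) = (∏_c ∏_{i<h c} A (x i) (x i)) · EC(P)`: after the expansion
`EC_mapForms_expand` only the box-functions `V = (c, r) ↦ x (κ_c r)`, `κ` a tuple of column
bijections, survive (`det_lookup_eq_zero`), each contributing `sign κ · ∏ diag`
(`det_lookup_perm`). This is the Borel-eigenvector property of the tableau functional
(Dörfler–Ikenmeyer–Panova 2020 §5; hwv `FORMAT.md` §2 (U)/(W)). [folklore] -/
theorem EC_mapForms [LinearOrder σ] (F : τ.Frame) {x : ℕ → σ} {N : ℕ} (hx : IsAntitoneEnum x N)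
    (hh : ∀ c, τ.h c ≤ N) (hvar : ∀ c r, τ.var c r = x r) {A : Matrix σ σ K}
    (hA : ∀ a b, b < a → A a b = 0) {T : ℕ} (coef : Fin T → K)
    (form : Fin T → Fin τ.m → σ → K) :
    τ.EC coef (mapForms A form) = (∏ c, ∏ i : Fin (τ.h c), A (x i) (x i)) * τ.EC coef form := by
  classical
  rw [EC_mapForms_expand F A coef form]
  -- the box-functions coming from column bijections
  let G : τ.Bij → ((c : Fin τ.C) → Fin (τ.h c) → σ) := fun κ c r => x (κ c r)
  have hG : Function.Injective G := by
    intro κ κ' hκ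
    funext c
    ext r
    have h1 : x (κ c r) = x (κ' c r) := congrFun (congrFun hκ c) r
    exact hx.inj (lt_of_lt_of_le (κ c r).isLt (hh c)) (lt_of_lt_of_le (κ' c r).isLt (hh c)) h1
  have hvarx : ∀ c (V : Fin (τ.h c) → σ),
      (Matrix.of fun i r : Fin (τ.h c) => A (τ.var c i) (V r)) =
        Matrix.of fun i r : Fin (τ.h c) => A (x i) (V r) := by
    intro c V
    ext i r
    rw [Matrix.of_apply, Matrix.of_apply, hvar]
  -- terms outside the image of `G` vanish
  have hzero : ∀ V ∈ (Finset.univ : Finset ((c : Fin τ.C) → Fin (τ.h c) → σ)),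
      V ∉ Finset.univ.image G →
        (∏ c, (Matrix.of fun i r : Fin (τ.h c) => A (τ.var c i) (V c r)).det) *
          ∏ u, symEntryM coef form (F.ofBoxFun V u) = 0 := by
    intro V _ hV
    have hc : ∃ c, ¬ ∃ ρ : Equiv.Perm (Fin (τ.h c)), ∀ r, V c r = x (ρ r) := by
      by_contra hall
      apply hV
      have hall' : ∀ c, ∃ ρ : Equiv.Perm (Fin (τ.h c)), ∀ r, V c r = x (ρ r) :=
        fun c => not_not.mp ((not_exists.mp hall) c)
      choose ρ hρ using hall'
      exact Finset.mem_image.mpr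
        ⟨ρ, Finset.mem_univ _, funext fun c => funext fun r => (hρ c r).symm⟩
    obtain ⟨c, hc⟩ := hc
    have hdet0 : (Matrix.of fun i r : Fin (τ.h c) => A (τ.var c i) (V c r)).det = 0 := by
      rw [hvarx c (V c)]
      exact det_lookup_eq_zero hA hx (V c) hc
    rw [Finset.prod_eq_zero (Finset.mem_univ c) hdet0, zero_mul]
  rw [← Finset.sum_subset (Finset.subset_univ (Finset.univ.image G)) hzero,
    Finset.sum_image fun κ _ κ' _ h => hG h]
  -- the surviving terms
  unfold EC
  rw [Finset.mul_sum]
  refine Finset.sum_congr rfl fun κ _ => ?_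
  have hdet : ∀ c, (Matrix.of fun i r : Fin (τ.h c) => A (τ.var c i) (G κ c r)).det =
      ((Equiv.Perm.sign (κ c) : ℤ) : K) * ∏ i : Fin (τ.h c), A (x i) (x i) := by
    intro c
    rw [hvarx c (G κ c)]
    exact det_lookup_perm hA hx (hh c) (κ c)
  have hS : ∀ u, F.ofBoxFun (G κ) u = τ.word κ u := by
    intro u
    funext s
    simp only [Frame.ofBoxFun, TabM.word]
    rw [hvar, F.box_eq u s]
  simp only [hdet, hS, Finset.prod_mul_distrib, TabM.sgnProd, Units.coe_prod, Int.cast_prod]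
  ring

end TabM

end TableauEval

end Literature.Computability.AlgebraicComplexity

end
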